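import Mathlib
import Summits.Ventures.HodgeRepro2.T5UnramifiedUniformiser

/-!
# The residue field of the ring of integers upstairs is finite

Blind cell `pub-hodge-repro2`, seat p8 (gen 13), Tier-5 kernel support.  The inert-place Hecke
package takes `[Finite (IsLocalRing.ResidueField R)]` for the DVR `R = 𝒪_{E_v}` — «the finiteness
of the residue field (an instance argument)» in CHECK-N3 §22 / annex §105.  This file derives it
from the finiteness of the residue field of the BASE `R₀ = 𝒪_{F_v}`: for a DVR `R₀` with fraction
field `F` and a finite separable extension `E / F`,

* `module_finite_integralClosure` — `𝒪_E = integralClosure R₀ E` is a finite `R₀`-module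
  (Mathlib's `IsIntegralClosure.finite`);
* `not_isUnit_algebraMap_of_irreducible` / `map_maximalIdeal_ne_top` — a uniformiser of `R₀` is
  not a unit of `𝒪_E`, so `𝔭_{R₀} 𝒪_E ≠ 𝒪_E` (its inverse would be integral over the integrally
  closed `R₀`);
* `finite_quotient_map_maximalIdeal` — `𝒪_E / 𝔭_{R₀} 𝒪_E` is a finite module over the finite
  field `R₀ / 𝔭_{R₀}`, hence finite;
* `finite_residueField_integralClosure` — **for `𝒪_E` local, its residue field `𝒪_E / 𝔪_E` is a
  quotient of `𝒪_E / 𝔭_{R₀} 𝒪_E`, hence finite**: the instance argument of the package is a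
  theorem once the base has a finite residue field.

README §8(d): uses an L-value-free non-vanishing device: NO.
-/

namespace Summit.Ventures.HodgeRepro2.T5ResidueFieldFinite

open IsLocalRing

variable (R₀ F E : Type*) [CommRing R₀] [IsDomain R₀] [IsDiscreteValuationRing R₀] [Field F]
  [Field E] [Algebra R₀ F] [IsFractionRing R₀ F] [Algebra F E] [Algebra R₀ E]
  [IsScalarTower R₀ F E]

section Finite

variable [FiniteDimensional F E] [Algebra.IsSeparable F E]

include F in
/-- The ring of integers `𝒪_E = integralClosure R₀ E` is a finite `R₀`-module. -/
theorem module_finite_integralClosure : Module.Finite R₀ (integralClosure R₀ E) :=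
  IsIntegralClosure.finite R₀ F E (integralClosure R₀ E)

end Finite

section Uniformiser

include F in
/-- A uniformiser of `R₀` is not a unit of `𝒪_E`: its inverse would be integral over the
integrally closed `R₀`. -/
theorem not_isUnit_algebraMap_of_irreducible {ϖ : R₀} (hϖ : Irreducible ϖ) :
    ¬ IsUnit (algebraMap R₀ (integralClosure R₀ E) ϖ) := by
  intro hu
  obtain ⟨d, hd⟩ := isUnit_iff_exists_inv.mp hu
  have hne : algebraMap R₀ F ϖ ≠ 0 :=
    (map_ne_zero_iff _ (IsFractionRing.injective R₀ F)).mpr hϖ.ne_zero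
  have h1 : algebraMap R₀ E ϖ * (d : E) = 1 := by
    have := congrArg (algebraMap (integralClosure R₀ E) E) hd
    rw [map_mul, map_one, ← IsScalarTower.algebraMap_apply R₀ (integralClosure R₀ E) E] at this
    exact this
  have hcE : algebraMap R₀ E ϖ = algebraMap F E (algebraMap R₀ F ϖ) :=
    IsScalarTower.algebraMap_apply R₀ F E ϖ
  have hd' : (d : E) = algebraMap F E (algebraMap R₀ F ϖ)⁻¹ := by
    rw [map_inv₀]
    rw [hcE] at h1
    exact eq_inv_of_mul_eq_one_right h1
  have hint : IsIntegral R₀ (algebraMap R₀ F ϖ)⁻¹ := by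
    have hdi := d.2
    rw [mem_integralClosure_iff, hd'] at hdi
    exact (isIntegral_algebraMap_iff (algebraMap F E).injective).mp hdi
  obtain ⟨y, hy⟩ := IsIntegrallyClosed.isIntegral_iff.mp hint
  apply hϖ.not_isUnit
  refine isUnit_iff_exists_inv.mpr ⟨y, ?_⟩
  apply IsFractionRing.injective R₀ F
  rw [map_mul, hy, map_one, mul_inv_cancel₀ hne]

include F in
/-- `𝔭_{R₀} 𝒪_E ≠ 𝒪_E`. -/
theorem map_maximalIdeal_ne_top :
    (maximalIdeal R₀).map (algebraMap R₀ (integralClosure R₀ E)) ≠ ⊤ := by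
  obtain ⟨ϖ, hϖ⟩ := IsDiscreteValuationRing.exists_irreducible R₀
  rw [T5UnramifiedUniformiser.map_maximalIdeal_eq_span hϖ, Ne, Ideal.span_singleton_eq_top]
  exact not_isUnit_algebraMap_of_irreducible R₀ F E hϖ

include F in
/-- For `𝒪_E` local, `𝔭_{R₀} 𝒪_E ≤ 𝔪_E`. -/
theorem map_maximalIdeal_le_maximalIdeal [IsLocalRing (integralClosure R₀ E)] :
    (maximalIdeal R₀).map (algebraMap R₀ (integralClosure R₀ E)) ≤
      maximalIdeal (integralClosure R₀ E) :=
  le_maximalIdeal (map_maximalIdeal_ne_top R₀ F E)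

end Uniformiser

section ResidueField

variable [FiniteDimensional F E] [Algebra.IsSeparable F E] [Finite (ResidueField R₀)]

include F in
/-- `𝒪_E / 𝔭_{R₀} 𝒪_E` is finite: a finite module over the finite residue field of `R₀`. -/
theorem finite_quotient_map_maximalIdeal :
    Finite (integralClosure R₀ E ⧸ (maximalIdeal R₀).map (algebraMap R₀ (integralClosure R₀ E))) := by
  haveI : Module.Finite R₀ (integralClosure R₀ E) := module_finite_integralClosure R₀ F E
  haveI : Module.Finite R₀
      (integralClosure R₀ E ⧸ (maximalIdeal R₀).map (algebraMap R₀ (integralClosure R₀ E))) :=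
    Module.Finite.quotient R₀ _
  haveI : Module.Finite (R₀ ⧸ maximalIdeal R₀)
      (integralClosure R₀ E ⧸ (maximalIdeal R₀).map (algebraMap R₀ (integralClosure R₀ E))) :=
    Module.Finite.of_restrictScalars_finite R₀ (R₀ ⧸ maximalIdeal R₀) _
  haveI : Finite (R₀ ⧸ maximalIdeal R₀) := ‹Finite (ResidueField R₀)›
  exact Module.finite_of_finite (R₀ ⧸ maximalIdeal R₀)

include F in
/-- **The residue field of `𝒪_E` is finite** when `𝒪_E` is local and the residue field of `R₀`
is finite: it is a quotient of `𝒪_E / 𝔭_{R₀} 𝒪_E`. -/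
theorem finite_residueField_integralClosure [IsLocalRing (integralClosure R₀ E)] :
    Finite (ResidueField (integralClosure R₀ E)) := by
  haveI := finite_quotient_map_maximalIdeal R₀ F E
  exact Finite.of_surjective _
    (Ideal.Quotient.factor_surjective (map_maximalIdeal_le_maximalIdeal R₀ F E))

end ResidueField

end Summit.Ventures.HodgeRepro2.T5ResidueFieldFinite
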